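import Summits.ResolutionOfSingularities.ResolutionOfSingularities.Theorems.RadicialJungCleanModelsCleanLU3CompositeAssemblyOfThm11
import Summits.ResolutionOfSingularities.ResolutionOfSingularities.Theorems.RadicialJungCleanModelsCleanLU3CompositeDownstairsCasesOfThm11
import Summits.ResolutionOfSingularities.ResolutionOfSingularities.Theorems.RadicialJungCleanModelsCleanLU3CompositeCdivCP
import HarnessLib

/-!
# (C-div) general divisorial case modulo CP 2019 only — Thm. 1.1 (i)–(iii) for the frame, `CossartPiltant2019` for the model

Route `RadicialJung`, crux `CleanModels` (stmt-ResolutionOfSingularities-15917), line `Sketch`, sub-line (C-div) of the research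
residual: the tree's theorem(s) of the same name WITHOUT the suffix `_thm11`, with the embedded-resolution HYPOTHESIS `hEmb` (CJS 2020
Cor. 1.5 shape; skeleton stub `stub_cjs2020Thm14` = F-32) REPLACED by the typed verbatim Cossart–Piltant 2019 Thm. 1.1 (i)–(iii)
`CP2019.CossartPiltant2019Thm11`, through the doubling trick (`Doubling.hEmb_zeroLocus_of_thm11`,
`exists_localRing_monomial_of_thm11_dim`).  Proof bodies are the tree's, verbatim — credit to the original files (seat res-B-lead-1 and
its workers); only the binder and the one threaded call differ.  OURS; nothing here proves resolution in characteristic `p`.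
-/

noncomputable section

set_option linter.dupNamespace false -- mandated namespace of this single-conjunct summit

open IsLocalRing AlgebraicGeometry CategoryTheory
open Literature.AlgebraicGeometry.Resolution

namespace Summit.ResolutionOfSingularities.ResolutionOfSingularities.Theorems.RadicialJung.CleanModels

variable {K : Type} [Field K] {k : Type} [Field k] [Algebra k K]

/-- **(C-div), general divisorial case, modulo `h11` (CP 2019 Thm. 1.1 (i)–(iii)), `CossartPiltant2019` and the downstairs package `hD2`** — ✓
`cleanLU3Defect_of_divisorialCoarsening_of_cleanMono` with F-78 replaced by F-02 (the regular model `A₃ ⊇ A ∪ {y₀, y₁}` along `O` now comes from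
`exists_regular_model_containing_of_cp`); the rest of the proof is unchanged: `A₃` has dimension `3`, the centre of `O₁` on `locAtCentre A₃ O`
has height one (✓ `locAtCentre_locAtCentre_eq_of_residually_independent`), and ✓ `cleanLU3Defect_of_heightOneCoarsening_of_cleanMono` concludes.
[cite: CossartPiltant2019, Thm. 1.1] -/
theorem cleanLU3Defect_of_divisorialCoarsening_of_cleanMono_cp_thm11
    (h11 : Literature.AlgebraicGeometry.CossartPiltant200819.CP2019.CossartPiltant2019Thm11.{0})
    (hCP : CossartPiltant2019.{0})
    (p : ℕ) (hp : p.Prime) (k : Type) [Field k] [CharP k p]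
    (hD2 : ∀ (κ : Type) [Field κ] [CharP κ p] [Algebra k κ]
      (Ō : ValuationSubring κ) (Ā : Subalgebra k κ), Ā.toSubring ≤ Ō.toSubring → Ā.FG → IsFractionRing Ā κ →
      IsRegularLocalRing (locAtCentre Ā.toSubring Ō) →
      ringKrullDim (locAtCentre Ā.toSubring Ō) = 2 →
      (∀ (T : Subring κ) (hT : T ≤ Ō.toSubring), Ā.toSubring ≤ T → (subringCentre T Ō hT).IsMaximal) →
      ∀ ū : κ, (∀ c : κ, c ^ p ≠ ū) →
      ∃ (Rb : ℕ → Subring κ), Rb 0 = locAtCentre Ā.toSubring Ō ∧ (∀ i, IsQuadraticTransformAlong Ō (Rb i) (Rb (i + 1))) ∧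
        ∃ (M : ℕ) (_ : IsRegularLocalRing (Rb M)), ringKrullDim (Rb M) = 2 ∧
        ∃ (c : Fin p → κ), (∃ j : Fin p, (j : ℕ) ≠ 0 ∧ c j ≠ 0) ∧
        ∃ (xb yb : Rb M), (xb : κ) ≠ 0 ∧ (yb : κ) ≠ 0 ∧ maximalIdeal (Rb M) = Ideal.span {xb, yb} ∧
        ∃ (Lb : List (κ × κ × ℕ)),
          (∀ t ∈ Lb, t.1 ≠ 0 ∧ ∃ (h₁ : t.1 ∈ Rb M) (h₂ : t.2.1 ∈ Rb M), maximalIdeal (Rb M) = Ideal.span {⟨_, h₁⟩, ⟨_, h₂⟩}) ∧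
          (∀ j : Fin p, c j * (Lb.map fun t => t.1 ^ t.2.2).prod ∈ Rb M) ∧
          ((∃ (a b : ℕ) (ε : Rb M), IsUnit ε ∧ (a ≠ 0 ∨ b ≠ 0) ∧ (a = 0 ∨ ¬ p ∣ a) ∧ (b = 0 ∨ ¬ p ∣ b) ∧
              (∑ j : Fin p, c j ^ p * ū ^ (j : ℕ)) = (ε : κ) * (xb : κ) ^ a * (yb : κ) ^ b) ∨
            (∃ w : Rb M, IsUnit w ∧ (∑ j : Fin p, c j ^ p * ū ^ (j : ℕ)) = (w : κ) ∧ ∀ c' : Rb M, w - c' ^ p ∉ maximalIdeal (Rb M)) ∨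
            (∃ s c' : Rb M, (∑ j : Fin p, c j ^ p * ū ^ (j : ℕ)) = (s : κ) ∧ s - c' ^ p ∈ maximalIdeal (Rb M) ∧
              s - c' ^ p ∉ maximalIdeal (Rb M) ^ 2)))
    (K : Type) [Field K] [Algebra k K]
    (O : ValuationSubring K) (A : Subalgebra k K) (hAO : A.toSubring ≤ O.toSubring) (hAfg : A.FG)
    (hfrac : IsFractionRing A K)
    (hdim3 : ringKrullDim (locAtCentre A.toSubring O) = 3)
    (hzd : ∀ (T : Subring K) (hT : T ≤ O.toSubring), A.toSubring ≤ T → (subringCentre T O hT).IsMaximal)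
    (g₀ : K) (hg₀ : ∀ c : K, c ^ p ≠ g₀)
    (hdefect : ∀ f₀ : K, ∃ f₁ : K, O.valuation (g₀ - f₁ ^ p) < O.valuation (g₀ - f₀ ^ p))
    (O₁ : ValuationSubring K) (hOO₁ : O ≤ O₁) (hO₁ : O₁ ≠ ⊤)
    (y : Fin 2 → K) (hy : ∀ i, y i ∈ O)
    (hind : ∀ P : MvPolynomial (Fin 2) k, P ≠ 0 → O₁.valuation (MvPolynomial.aeval y P) = 1) :
    ∃ (A' : Subalgebra k K), A'.toSubring ≤ O.toSubring ∧ A ≤ A' ∧ A'.FG ∧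
    ∃ (_ : IsRegularLocalRing (locAtCentre A'.toSubring O)) (c : Fin p → K), (∃ j : Fin p, (j : ℕ) ≠ 0 ∧ c j ≠ 0) ∧
    ((∃ (d m : ℕ) (hmd : m ≤ d) (t : Fin d → ↥(locAtCentre A'.toSubring O)) (a : Fin m → ℕ) (u : ↥(locAtCentre A'.toSubring O)), IsUnit u ∧
    Ideal.span (Set.range t) = IsLocalRing.maximalIdeal ↥(locAtCentre A'.toSubring O) ∧
    ringKrullDim ↥(locAtCentre A'.toSubring O) = (d : WithBot ℕ∞) ∧ 0 < m ∧ (∀ i, ¬ p ∣ a i) ∧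
    (∑ j : Fin p, c j ^ p * g₀ ^ (j : ℕ)) = (u : K) * ∏ i : Fin m, ((t (Fin.castLE hmd i) : ↥(locAtCentre A'.toSubring O)) : K) ^ (a i)) ∨
    (∃ u : ↥(locAtCentre A'.toSubring O), IsUnit u ∧ (∑ j : Fin p, c j ^ p * g₀ ^ (j : ℕ)) = (u : K) ∧
    ∀ c' : ↥(locAtCentre A'.toSubring O), u - c' ^ p ∉ IsLocalRing.maximalIdeal ↥(locAtCentre A'.toSubring O)) ∨
    (∃ s c' : ↥(locAtCentre A'.toSubring O), (∑ j : Fin p, c j ^ p * g₀ ^ (j : ℕ)) = (s : K) ∧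
    s - c' ^ p ∈ IsLocalRing.maximalIdeal ↥(locAtCentre A'.toSubring O) ∧
    s - c' ^ p ∉ IsLocalRing.maximalIdeal ↥(locAtCentre A'.toSubring O) ^ 2)) := by
  classical
  haveI : IsFractionRing A K := hfrac
  -- dimension of `A`
  have hdimA : ringKrullDim A = 3 := by
    rw [← ringKrullDim_locAtCentre_eq_of_isMaximal A hAfg O hAO (hzd _ hAO le_rfl)]; exact hdim3
  -- a regular model `A₃ ⊇ A ∪ {y₀, y₁}` along `O` (F-02)
  obtain ⟨A₃, hA₃O, hAA₃, hA₃fg, hyA₃, hreg₃⟩ := exists_regular_model_containing_of_cp hCP O A hAO hAfg hdimA.le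
    (Finset.univ.image y) (by
      intro z hz
      rw [Finset.coe_image] at hz
      obtain ⟨i, -, rfl⟩ := hz
      exact hy i)
  have hyA₃' : ∀ i, y i ∈ A₃ := fun i => hyA₃ (by
    rw [Finset.coe_image]; exact ⟨i, Finset.mem_coe.mpr (Finset.mem_univ i), rfl⟩)
  haveI hfrac₃ : IsFractionRing A₃ K := isFractionRing_of_le hAA₃ hfrac
  have hzd₃ : ∀ (T : Subring K) (hT : T ≤ O.toSubring), A₃.toSubring ≤ T → (subringCentre T O hT).IsMaximal :=
    fun T hT h => hzd T hT (le_trans (fun z hz => hAA₃ hz) h)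
  -- dimensions
  have hdimA₃ : ringKrullDim A₃ = 3 := by
    rw [ringKrullDim_eq_of_fg_of_le hAfg hA₃fg hAA₃]; exact hdimA
  have hdim3₃ : ringKrullDim (locAtCentre A₃.toSubring O) = 3 := by
    rw [ringKrullDim_locAtCentre_eq_of_isMaximal A₃ hA₃fg O hA₃O (hzd₃ _ hA₃O le_rfl)]; exact hdimA₃
  -- the centre of `O₁` on `locAtCentre A₃ O` has height one
  have hloc₃ : locAtCentre (locAtCentre A₃.toSubring O) O₁ = O₁.toSubring :=
    locAtCentre_locAtCentre_eq_of_residually_independent hOO₁ hO₁ A₃ hA₃O hA₃fg hreg₃ hdimA₃ y hyA₃' hind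
  obtain ⟨A', hA'O, hA₃A', hA'fg, hrest⟩ := cleanLU3Defect_of_heightOneCoarsening_of_cleanMono_thm11 h11 p hp k hD2 K O A₃
    hA₃O hA₃fg hfrac₃ hreg₃ hdim3₃ hzd₃ g₀ hg₀ hdefect O₁ hOO₁ hO₁ hloc₃
  exact ⟨A', hA'O, hAA₃.trans hA₃A', hA'fg, hrest⟩

/-- **(C-div), GENERAL DIVISORIAL CASE — THEOREM modulo `h11 : CP2019.CossartPiltant2019Thm11` and `hCP : CossartPiltant2019` (F-02) only — no F-32** — ✓
`cleanLU3Defect_of_divisorialCoarsening` with F-78 `CossartJannsenSaito2020General` replaced by F-02 `CossartPiltant2019` and WITHOUT the hypothesis `hreg` (local uniformization from F-02 needs no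
regularity of the given model); statement otherwise identical: at a zero-dimensional `O` with a 3-dimensional regular finitely generated centre, `g₀ ∉ K^p` without best `p`-th-power approximation,
and a DIVISORIAL coarsening `O ≤ O₁ ≠ K` (two elements of `O` residually algebraically independent in `κ(O₁)`), some finitely generated model
`A' ⊇ A` inside `O`, regular at the centre, carries a loosely clean representative of the `K^p`-line of `g₀`.  Composition of
`cleanLU3Defect_of_divisorialCoarsening_of_cleanMono_cp` with the landed downstairs package (✓ `exists_cleanMono_stage_of_cases` over ✓
`stub_cleanLU2`, ✓ `stub_persistCases`, ✓ `stub_persistE1`, ✓ `stub_persistE2`), exactly as in `…CleanLU3CompositeCdiv.lean`. [folklore] -/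
theorem cleanLU3Defect_of_divisorialCoarsening_cp_thm11
    (h11 : Literature.AlgebraicGeometry.CossartPiltant200819.CP2019.CossartPiltant2019Thm11.{0})
    (hCP : CossartPiltant2019.{0})
    (p : ℕ) (hp : p.Prime) (k : Type) [Field k] [CharP k p] (K : Type) [Field K] [Algebra k K]
    (O : ValuationSubring K) (A : Subalgebra k K) (hAO : A.toSubring ≤ O.toSubring) (hAfg : A.FG)
    (hfrac : IsFractionRing A K)
    (hdim3 : ringKrullDim (locAtCentre A.toSubring O) = 3)
    (hzd : ∀ (T : Subring K) (hT : T ≤ O.toSubring), A.toSubring ≤ T → (subringCentre T O hT).IsMaximal)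
    (g₀ : K) (hg₀ : ∀ c : K, c ^ p ≠ g₀)
    (hdefect : ∀ f₀ : K, ∃ f₁ : K, O.valuation (g₀ - f₁ ^ p) < O.valuation (g₀ - f₀ ^ p))
    (O₁ : ValuationSubring K) (hOO₁ : O ≤ O₁) (hO₁ : O₁ ≠ ⊤)
    (y : Fin 2 → K) (hy : ∀ i, y i ∈ O)
    (hind : ∀ P : MvPolynomial (Fin 2) k, P ≠ 0 → O₁.valuation (MvPolynomial.aeval y P) = 1) :
    ∃ (A' : Subalgebra k K), A'.toSubring ≤ O.toSubring ∧ A ≤ A' ∧ A'.FG ∧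
    ∃ (_ : IsRegularLocalRing (locAtCentre A'.toSubring O)) (c : Fin p → K), (∃ j : Fin p, (j : ℕ) ≠ 0 ∧ c j ≠ 0) ∧
    ((∃ (d m : ℕ) (hmd : m ≤ d) (t : Fin d → ↥(locAtCentre A'.toSubring O)) (a : Fin m → ℕ) (u : ↥(locAtCentre A'.toSubring O)), IsUnit u ∧
    Ideal.span (Set.range t) = IsLocalRing.maximalIdeal ↥(locAtCentre A'.toSubring O) ∧
    ringKrullDim ↥(locAtCentre A'.toSubring O) = (d : WithBot ℕ∞) ∧ 0 < m ∧ (∀ i, ¬ p ∣ a i) ∧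
    (∑ j : Fin p, c j ^ p * g₀ ^ (j : ℕ)) = (u : K) * ∏ i : Fin m, ((t (Fin.castLE hmd i) : ↥(locAtCentre A'.toSubring O)) : K) ^ (a i)) ∨
    (∃ u : ↥(locAtCentre A'.toSubring O), IsUnit u ∧ (∑ j : Fin p, c j ^ p * g₀ ^ (j : ℕ)) = (u : K) ∧
    ∀ c' : ↥(locAtCentre A'.toSubring O), u - c' ^ p ∉ IsLocalRing.maximalIdeal ↥(locAtCentre A'.toSubring O)) ∨
    (∃ s c' : ↥(locAtCentre A'.toSubring O), (∑ j : Fin p, c j ^ p * g₀ ^ (j : ℕ)) = (s : K) ∧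
    s - c' ^ p ∈ IsLocalRing.maximalIdeal ↥(locAtCentre A'.toSubring O) ∧
    s - c' ^ p ∉ IsLocalRing.maximalIdeal ↥(locAtCentre A'.toSubring O) ^ 2)) :=
  cleanLU3Defect_of_divisorialCoarsening_of_cleanMono_cp_thm11 h11 hCP p hp k
    (fun κ _ _ _ Ō Ā hĀŌ hĀfg hfr hregb hdimb hzdb ū hū => by
      haveI : Fact p.Prime := ⟨hp⟩
      haveI := hfr
      exact exists_cleanMono_stage_of_cases_thm11 h11 p (stub_cleanLU2 p hp k κ) (stub_persistCases p κ) (stub_persistE1 p κ)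
        (stub_persistE2 p κ) Ō Ā hĀŌ hĀfg hregb hdimb hzdb ū hū)
    K O A hAO hAfg hfrac hdim3 hzd g₀ hg₀ hdefect O₁ hOO₁ hO₁ y hy hind


end Summit.ResolutionOfSingularities.ResolutionOfSingularities.Theorems.RadicialJung.CleanModels

end
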